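import Mathlib

/-! # The absorbing weight profile — crux stmt-NavierStokesRegularity-14061 (`SymmetryModuliCount.AxisymEndLiouville`), line absorbing-axis-swirl-extinction, stub stub_swirlWeightProfile

Pure real analysis (no fluid objects). For every `C ≥ 0` we produce `λ > 0`, `K > 0` and an
explicit function `W : ℝ → ℝ`, continuous on `[0, ∞)` and `C²` on `(0, ∞)` (in fact `C²` on `ℝ`),
with `W ≥ 0`, `W' ≥ 0`, `ρ ≤ K W(ρ)` and the supersolution inequality for the radial part of the
self-similar swirl operator,
`W'' − (ρ/2 + 1/ρ − C) W' + λ W ≤ 0` on `(0, ∞)`.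
`W` is the radial weight of the supersolution `Ψ = K (t/t')^λ W(r/√(−t))` consumed by the weighted
maximum principle for the swirl (`stub_swirlComparison` of the same line); only the six listed
properties are used downstream.

Construction. `W(ρ) := 1 + ∫₀^ρ W₁` with the slope
`W₁(ρ) := exp (2 e^{C − ρ/2} − 2 e^C) = exp (−∫₀^ρ e^{C − s/2} ds)`, so that `W' = W₁`,
`W'' = −e^{C − ρ/2} W₁`, and `w₀ := e^{−2 e^C} ≤ W₁ ≤ 1` on `[0, ∞)`, whence
`1 + w₀ ρ ≤ W(ρ) ≤ 1 + ρ` there. With `φ := ρ/2 + 1/ρ − C` the operator applied to `W` is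
`−(e^{C − ρ/2} + φ) W₁ + λ W`, and `e^{C − ρ/2} + φ ≥ max (1, ρ/2 − C)` (`e^x ≥ 1 + x`, `1/ρ > 0`).
The constants `λ := w₀ / (4C + 5)` and `K := w₀⁻¹ = e^{2 e^C}` then work (case split at
`ρ = 4C + 4`). Mathlib only. -/

noncomputable section

open Set MeasureTheory intervalIntegral
open scoped ContDiff

-- the summit and its single problem share the name (D-0017 nested layout)
set_option linter.dupNamespace false

namespace Summit.NavierStokesRegularity.NavierStokesRegularity.Theorems.AxisymEndLiouville.AbsorbingAxisSwirlExtinction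

/-- Calculus of the primitive `F = 1 + ∫₀ f` of an everywhere differentiable `f` with continuous
derivative `f'`: `F` is `C²`, `F' = f` and `F'' = f'`. -/
theorem primitive_calculus (f f' : ℝ → ℝ) (hf : ∀ x, HasDerivAt f (f' x) x)
    (hf' : Continuous f') :
    ContDiff ℝ 2 (fun ρ => 1 + ∫ s in (0 : ℝ)..ρ, f s) ∧
      deriv (fun ρ => 1 + ∫ s in (0 : ℝ)..ρ, f s) = f ∧
      ∀ ρ, deriv (deriv fun ρ => 1 + ∫ s in (0 : ℝ)..ρ, f s) ρ = f' ρ := by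
  have hfc : Continuous f := continuous_iff_continuousAt.2 fun x => (hf x).continuousAt
  have hF : ∀ ρ, HasDerivAt (fun ρ => 1 + ∫ s in (0 : ℝ)..ρ, f s) (f ρ) ρ := fun ρ =>
    (hfc.integral_hasStrictDerivAt 0 ρ).hasDerivAt.const_add 1
  have hF' : deriv (fun ρ => 1 + ∫ s in (0 : ℝ)..ρ, f s) = f := funext fun ρ => (hF ρ).deriv
  have hdf : deriv f = f' := funext fun x => (hf x).deriv
  have hf1 : ContDiff ℝ 1 f :=
    contDiff_one_iff_deriv.2 ⟨fun x => (hf x).differentiableAt, hdf ▸ hf'⟩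
  refine ⟨?_, hF', fun ρ => by rw [hF', hdf]⟩
  rw [show (2 : ℕ∞ω) = 1 + 1 by norm_num, contDiff_succ_iff_deriv]
  refine ⟨fun ρ => (hF ρ).differentiableAt, fun h => absurd h (by simp), ?_⟩
  rw [hF']
  exact hf1

/-- Bounds for the primitive of a continuous `f` with `w₀ ≤ f ≤ 1` on `[0, ∞)`:
`w₀ ρ ≤ ∫₀^ρ f ≤ ρ` for `ρ ≥ 0`. -/
theorem primitive_bounds (f : ℝ → ℝ) (w₀ : ℝ) (hfc : Continuous f)
    (hf : ∀ s, 0 ≤ s → w₀ ≤ f s ∧ f s ≤ 1) (ρ : ℝ) (hρ : 0 ≤ ρ) :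
    w₀ * ρ ≤ ∫ s in (0 : ℝ)..ρ, f s ∧ ∫ s in (0 : ℝ)..ρ, f s ≤ ρ := by
  constructor
  · calc w₀ * ρ = ∫ _ in (0 : ℝ)..ρ, w₀ := by
          rw [intervalIntegral.integral_const, smul_eq_mul]; ring
      _ ≤ ∫ s in (0 : ℝ)..ρ, f s :=
        integral_mono_on hρ (by simp) (hfc.intervalIntegrable _ _) fun s hs => (hf s hs.1).1
  · calc ∫ s in (0 : ℝ)..ρ, f s ≤ ∫ _ in (0 : ℝ)..ρ, (1 : ℝ) :=
        integral_mono_on hρ (hfc.intervalIntegrable _ _) (by simp) fun s hs => (hf s hs.1).2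
      _ = ρ := by rw [intervalIntegral.integral_const, smul_eq_mul]; ring

/-- The slope `W₁(ρ) = exp (2 e^{C − ρ/2} − 2 e^C)`: derivative `−e^{C − ρ/2} W₁(ρ)`. -/
theorem hasDerivAt_slope (C ρ : ℝ) :
    HasDerivAt (fun s => Real.exp (2 * Real.exp (C - s / 2) - 2 * Real.exp C))
      (-Real.exp (C - ρ / 2) * Real.exp (2 * Real.exp (C - ρ / 2) - 2 * Real.exp C)) ρ := by
  have h1 : HasDerivAt (fun s => C - s / 2) (-(1 / 2)) ρ := by
    simpa using ((hasDerivAt_id ρ).div_const 2).const_sub C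
  have h2 := (((h1.exp).const_mul 2).sub_const (2 * Real.exp C)).exp
  refine h2.congr_deriv ?_
  ring

/-- The slope is squeezed: `e^{−2 e^C} ≤ W₁` everywhere and `W₁ ≤ 1` on `[0, ∞)`. -/
theorem slope_bounds (C s : ℝ) :
    Real.exp (-(2 * Real.exp C)) ≤ Real.exp (2 * Real.exp (C - s / 2) - 2 * Real.exp C) ∧
      (0 ≤ s → Real.exp (2 * Real.exp (C - s / 2) - 2 * Real.exp C) ≤ 1) := by
  refine ⟨Real.exp_le_exp.2 (by linarith [Real.exp_pos (C - s / 2)]), fun hs => ?_⟩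
  rw [Real.exp_le_one_iff, sub_nonpos]
  exact mul_le_mul_of_nonneg_left (Real.exp_le_exp.2 (by linarith)) (by norm_num)

/-- The pointwise inequality behind the supersolution property (pure algebra). For `ρ > 0`,
`C ≥ 0`, a slope value `W₁ ≥ w₀ > 0` and a profile value `W ≤ 1 + ρ`:
`−e^{C − ρ/2} W₁ − (ρ/2 + 1/ρ − C) W₁ + (w₀/(4C+5)) W ≤ 0`. -/
theorem supersolution_algebra (C ρ w₀ W₁ W : ℝ) (hC : 0 ≤ C) (hρ : 0 < ρ) (hw₀ : 0 < w₀)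
    (hW₁ : w₀ ≤ W₁) (hW : W ≤ 1 + ρ) :
    -Real.exp (C - ρ / 2) * W₁ - (ρ / 2 + 1 / ρ - C) * W₁ + w₀ / (4 * C + 5) * W ≤ 0 := by
  have hρ' : 0 < 1 / ρ := one_div_pos.2 hρ
  have hexp := Real.add_one_le_exp (C - ρ / 2)
  have hexp0 := Real.exp_pos (C - ρ / 2)
  -- `a + φ ≥ max (1, ρ/2 - C)`
  set q : ℝ := Real.exp (C - ρ / 2) + (ρ / 2 + 1 / ρ - C) with hq
  have hq1 : 1 ≤ q := by rw [hq]; linarith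
  have hq2 : ρ / 2 - C ≤ q := by rw [hq]; linarith
  have h45 : 0 < 4 * C + 5 := by linarith
  -- `(1 + ρ)/(4C+5) ≤ q`
  have hkey : 1 + ρ ≤ q * (4 * C + 5) := by
    rcases le_or_gt ρ (4 * C + 4) with h | h
    · calc 1 + ρ ≤ 1 * (4 * C + 5) := by linarith
        _ ≤ q * (4 * C + 5) := mul_le_mul_of_nonneg_right hq1 h45.le
    · calc 1 + ρ ≤ (ρ / 2 - C) * 4 := by linarith
        _ ≤ (ρ / 2 - C) * (4 * C + 5) := mul_le_mul_of_nonneg_left (by linarith) (by linarith)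
        _ ≤ q * (4 * C + 5) := mul_le_mul_of_nonneg_right hq2 h45.le
  have hlam : 0 ≤ w₀ / (4 * C + 5) := by positivity
  have step1 : w₀ / (4 * C + 5) * W ≤ w₀ / (4 * C + 5) * (1 + ρ) :=
    mul_le_mul_of_nonneg_left hW hlam
  have step2 : w₀ / (4 * C + 5) * (1 + ρ) ≤ w₀ * q := by
    rw [div_mul_eq_mul_div, div_le_iff₀ h45, mul_assoc]
    exact mul_le_mul_of_nonneg_left hkey hw₀.le
  have step3 : w₀ * q ≤ W₁ * q := mul_le_mul_of_nonneg_right hW₁ (by linarith)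
  have : -Real.exp (C - ρ / 2) * W₁ - (ρ / 2 + 1 / ρ - C) * W₁ = -(W₁ * q) := by rw [hq]; ring
  rw [this]
  linarith

/-- **STUB 2 of the line `absorbing-axis-swirl-extinction`** (the absorbing weight profile,
explicit for every `C ≥ 0`). There are `λ > 0`, `K > 0` and `W : ℝ → ℝ`, continuous on `[0, ∞)`,
`C²` on `(0, ∞)`, with `W ≥ 0`, `W' ≥ 0`, `ρ ≤ K W(ρ)` and the supersolution inequality
`W'' − (ρ/2 + 1/ρ − C) W' + λ W ≤ 0` on `(0, ∞)`.
Witnesses: `W(ρ) = 1 + ∫₀^ρ exp (2 e^{C − s/2} − 2 e^C) ds`, `λ = e^{−2 e^C} / (4C + 5)`,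
`K = e^{2 e^C}`. -/
theorem stub_swirlWeightProfile (C : ℝ) (hC : 0 ≤ C) :
    ∃ lam K : ℝ, 0 < lam ∧ 0 < K ∧ ∃ W : ℝ → ℝ, ContinuousOn W (Ici 0) ∧
      ContDiffOn ℝ 2 W (Ioi 0) ∧ (∀ ρ, 0 ≤ ρ → 0 ≤ W ρ) ∧ (∀ ρ, 0 < ρ → ρ ≤ K * W ρ) ∧
      (∀ ρ, 0 < ρ → 0 ≤ deriv W ρ) ∧
      ∀ ρ, 0 < ρ → deriv (deriv W) ρ - (ρ / 2 + 1 / ρ - C) * deriv W ρ + lam * W ρ ≤ 0 := by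
  -- the slope, its derivative, and the calculus of the profile `W = 1 + ∫₀ W₁`
  have hder := hasDerivAt_slope C
  have hf'c : Continuous fun ρ : ℝ =>
      -Real.exp (C - ρ / 2) * Real.exp (2 * Real.exp (C - ρ / 2) - 2 * Real.exp C) := by
    fun_prop
  obtain ⟨hF2, hF1, hF''⟩ := primitive_calculus _ _ hder hf'c
  have hfc : Continuous fun s : ℝ => Real.exp (2 * Real.exp (C - s / 2) - 2 * Real.exp C) := by
    fun_prop
  have hbd := primitive_bounds _ (Real.exp (-(2 * Real.exp C))) hfc
    (fun s hs => ⟨(slope_bounds C s).1, (slope_bounds C s).2 hs⟩)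
  have hw₀ : 0 < Real.exp (-(2 * Real.exp C)) := Real.exp_pos _
  refine ⟨Real.exp (-(2 * Real.exp C)) / (4 * C + 5), Real.exp (2 * Real.exp C),
    by positivity, Real.exp_pos _,
    fun ρ => 1 + ∫ s in (0 : ℝ)..ρ, Real.exp (2 * Real.exp (C - s / 2) - 2 * Real.exp C),
    hF2.continuous.continuousOn, hF2.contDiffOn, fun ρ hρ => ?_, fun ρ hρ => ?_, fun ρ _ => ?_,
    fun ρ hρ => ?_⟩
  · -- `W ≥ 0` on `[0, ∞)` (indeed `W ≥ 1`)
    have h := (hbd ρ hρ).1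
    have : 0 ≤ Real.exp (-(2 * Real.exp C)) * ρ := by positivity
    linarith
  · -- `ρ ≤ K W(ρ)`
    have h := (hbd ρ hρ.le).1
    have hK : Real.exp (2 * Real.exp C) * Real.exp (-(2 * Real.exp C)) = 1 := by
      rw [← Real.exp_add]; simp
    calc ρ = Real.exp (2 * Real.exp C) * (Real.exp (-(2 * Real.exp C)) * ρ) := by
          rw [← mul_assoc, hK, one_mul]
      _ ≤ Real.exp (2 * Real.exp C) *
            (1 + ∫ s in (0 : ℝ)..ρ, Real.exp (2 * Real.exp (C - s / 2) - 2 * Real.exp C)) :=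
          mul_le_mul_of_nonneg_left (by linarith) (Real.exp_pos _).le
  · -- `W' = W₁ ≥ 0`
    rw [hF1]
    exact (Real.exp_pos _).le
  · -- the supersolution inequality
    rw [hF'', hF1]
    exact supersolution_algebra C ρ _ _ _ hC hρ hw₀ (slope_bounds C ρ).1
      (by linarith [(hbd ρ hρ.le).2])

end Summit.NavierStokesRegularity.NavierStokesRegularity.Theorems.AxisymEndLiouville.AbsorbingAxisSwirlExtinction

end
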